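import Mathlib
import HarnessLib
import HarnessLib.Audit
import Summits.CriticalPhenomena.Statement
import Literature.Probability.LatticeModels.RandomCurrents
import HarnessLib.Audit.Status.Attr

/-!
Route: LinkingParityCircles

DORMANT since 2026-08-29T19:34:58Z (census g0: costume|duplicate of —; reader census-reader-38-g0) — unstaffed, not closed; items shared with open routes are served there. `ledger route dormant <id> --off` reactivates.

# Route LinkingParityCircles — Moebius invariance of linking-parity statistics of critical currents
with round disorder circles, entered through a zero-free-function Cardy profile; spins are the k=0
corner

Route LinkingParityCircles (idea card linking-parity-cardy-disorder-circles). Enlarge the target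
family from spin n-point functions to
n SPINS + k ROUND DISORDER CIRCLES: for a closed lattice loop C = ∂S insert μ_S := ∏_{b ∈ S}
e^{−2β_c σ_b} (Kadanoff–Ceva / Wegner:
couplings flipped across the spanning surface S; BilloEtAl2013 §3: the lattice monodromy = twist
line defect of the 3D Ising model) and
study the WEIGHT-FREE ratios G_C(x₁…x_n) := ⟨∏σ_{x_i} μ_S⟩⁺⟨1⟩/(⟨∏σ_{x_i}⟩⁺⟨μ_S⟩⁺) at β_c(3) —
bounded, renormalisation-free, and by the
random-current representation equal to ratios of characteristic functions of the mod-2 flux of the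
critical current through S (for ∂n = ∅:
the LINKING NUMBER mod 2 of the current with C). It suffices to show X = X_circle ∧ X_spin:
X_circle (the line's entry sector, k = 1): (C1 = CardyDisorderCircle) the energy density near a
round disorder circle of radius R has the
RIGID profile δ^{−Δ_ε}(⟨ε_b(x)⟩_C − ⟨ε⟩) → A·u_R(x)^{−Δ_ε}, u_R(x) = [(|x|²−R²)² +
4R²x₃²]^{1/2}/(2R), ONE exponent and ONE amplitude for all
radii, all three bond directions and all x off the circle (zero free functions: the (point, circle)
sector has an open Möb(3)-orbit);
(C2 = DisorderCircleInversion) the two-spin/one-circle ratio for the unit circle converges off the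
spanning disc and |g| is invariant under
EVERY inversion in a sphere through the circle (centres (0,0,h), radii (1+h²)^{1/2} — the conformal
stabiliser of C beyond its isometries).
X_spin (the k = 0 corner, which alone implies the conjunct): (K0 = SpinRatioMoebius) the ratios
⟨σ_{x₁}⋯σ_{x_{2m}}⟩/∏_j⟨σ_{x_j}σ_{x_{j+m}}⟩
converge locally uniformly on non-coincident configurations to a Möbius-INVARIANT family q (weight
0); (0634, shared) the two-point
function is an isotropic pure power law; (0636, shared) every non-degenerate limit has U₄ ≢ 0;
(support) odd correlations vanish.
Lean: `Assembly := SpinRatioMoebius → OddSpinCorrelationsVanish → IsingEuclidUpgradeR2RotInvPowerLaw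
→ IsingEuclidUpgradeR4NonGaussian → Ising3DConformalLimit` — every item a one-line Prop over
Literature.Probability.LatticeModels.{plusExpect, criticalBeta, spinAt, latticeApprox, criticalCorr,
criticalTwoPoint, CorrFamily, IsMoebiusCovariant, NonCoincident, HasPointwiseScalingLimit,
IsNondegenerateTwoPoint, HasNontrivialU4, Site, Current, currentSum, isingExpect, spinProduct,
bondSpin}, Mathlib's TendstoLocallyUniformlyOn, EuclideanGeometry.inversion, EuclideanSpace.single,
Finset.Icc/filter, Real.exp/sqrt/rpow (all elaborated rc 0 in the planner's Sketch.lean; `lean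
search --decl` / #check verified).

## Assembly
Standard reductions, no new idea (checked as a well-typed chain in Sketch.lean; expected 300–600
lines of Lean): from 0634 take Δ, c and put ρ(δ) := δ^{−Δ} (> 0 on (0,1]; Δ ≥ 1/2 > 0 by
criticalTwoPoint_bounds_holds); translation invariance (plusCorr_shift) turns 0634 into
ρ(δ)²⟨σ_{[x/δ]}σ_{[y/δ]}⟩ → c|x−y|^{−2Δ} locally uniformly off the diagonal; from SpinRatioMoebius
take q and set S_{2m}(x) := q_{2m}(x)·∏_{j<m} c|x_j − x_{j+m}|^{−2Δ}, S_{odd} := 0. Then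
HasPointwiseScalingLimit (criticalCorr 3) ρ S: even n = product of locally uniform limits (ratio × m
rescaled two-point factors), odd n by OddSpinCorrelationsVanish, n = 0 trivially;
IsNondegenerateTwoPoint: q₂ ≡ 1 on NonCoincident (the lattice ratio is identically 1 once ⟨σσ⟩ > 0,
which 0634 gives cofinitely) and c > 0; IsMoebiusCovariant Δ S: q has weight 0, each factor
c|x_a−x_b|^{−2Δ} is Euclidean invariant, scales with c^{−2Δ} and picks (|x_a||x_b|)^{2Δ} under the
unit inversion (EuclideanGeometry.dist_inversion_inversion), the pairing covers every point once,
odd n is 0 = 0; finally 0636 applied to (ρ, S) gives HasNontrivialU4 S, and ⟨ρ, Δ, S, …⟩ is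
Ising3DConformalLimit (root abbrev of
Literature.Probability.LatticeModels.CritIsing3DConformalLimit). CardyDisorderCircle and
DisorderCircleInversion are deliberately NOT antecedents: they are the k = 1 members of the same
family, the line's proving ground, and do not imply the k = 0 corner.

Rationale: WHY THIS LINE. Möbius maps send circles to circles and Möb(3) acts on (point, circle) pairs with an
open orbit, so in the sector "one local operator + one
round twist circle" conformal covariance is a CLOSED FORMULA (Cardy–Smirnov situation: no free
function), and in the sector "two spins + one
circle" it is a statement about a function of two invariants; the lattice offers these sectors
exactly: the disorder loop is a product of
flipped couplings (KadanoffCeva1971, Wegner1971; BilloEtAl2013 §3 p.5: flip the couplings crossing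
S, gauge-deform S, only L = ∂S matters;
the twist line is conjectured — and tested by Monte Carlo, BilloEtAl2013 §4 p.10: ⟨σ_iσ_j(x)⟩_defect
= const + a_ε|x_⊥|^{−Δ_ε} — to flow to
a conformal line defect, bootstrapped in GaiottoMazacPaulos2014 §3.3), the order–disorder
correlators are random-current sums signed by
the crossing parity (−1)^{n(S)} (AizenmanEtAl2019 §6, dimension-free; here S is a surface and the
sign is a linking parity — the one
genuinely three-dimensional topological functional of currents, the analogue of planar winding), and
the elementary loop is the energy
operator (μ_{∂b*} = cosh2β − sinh2β σ_b). Imported areas: defect CFT kinematics (BilloEtAl2016: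
one-point functions near a circular
defect), ℤ₂ gauge duality (Wegner1971), random currents with switching (Aizenman1982,
DuminilCopin2016, in tree and proved:
isingCorr_free_eq_currentSum_div_holds, currentSum_switching_holds), Möbius geometry of circles
(Mathlib EuclideanGeometry.inversion). What
no prior route does:
IsingEuclidUpgrade/IsingCFTData/HyperoctahedralRP/PerfectScreening/AnomalousForcesInteraction all
work on bare spin
correlators or their two-point kernel; none has a defect/disorder sector, a topological statistic of
currents, or a zero-free-function
target. The negatives index (one SAW item) is not touched. Honest logic: the k ≥ 1 sectors do not
imply the k = 0 corner (an infinite twist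
plane is invisible: unique critical Gibbs state + gauge), so the Assembly runs through X_spin;
X_circle is where the inversion mechanism for
current statistics is to be proved first and falsified cheapest, and its refutation closes THIS line
(Kill criteria).

RANKED CRUXES. #2 CardyDisorderCircle (crux) — [card N3, the entry theorem] There are Δ_ε > 0 and A
≠ 0 such that for every radius R > 0 and every bond direction i ∈ {0,1,2}: with D_{R/δ} the set of
vertical bonds {(p,0),(p,1)}, p ∈ ℤ², p₁²+p₂² < (R/δ)² (a flat disc of flipped couplings whose
boundary is the lattice circle of radius R/δ), μ := exp(−2β_c Σ_{b∈D} σ_b), ε_b(x) := J_b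
σ_{[x/δ]}σ_{[x/δ]+e_i} the energy density of the TWISTED Hamiltonian (J_b = −1 on the flipped bonds,
else +1: gauge-covariant, no artefact on the disc), the rescaled profile δ^{−Δ_ε}·(⟨ε_b(x)
μ⟩⁺_{β_c}/⟨μ⟩⁺_{β_c} − ⟨σ_0σ_{e_i}⟩⁺_{β_c}) converges as δ → 0⁺, locally uniformly on ℝ³ minus the
circle {x₃ = 0, |x| = R}, to A·u_R(x)^{−Δ_ε} with u_R(x) = ((|x|²−R²)² + 4R²x₃²)^{1/2}/(2R). One
exponent, one amplitude, no free function: scale covariance (A independent of R), isotropy (A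
independent of i) and inversion covariance (the shape u_R, Möbius image of the straight-line law
a_ε|x_⊥|^{−Δ_ε}) in a single formula; A/a_ε = 1 is predicted by BilloEtAl2013's measured line
amplitude on the same lattice with the same probe. [difficulty: open-problem] (why it might fail:
Presumes the lattice twist loop flows to the CONFORMAL line defect (IR assumption, MC-tested not
proved: BilloEtAl2013 §4) with no relevant symmetric defect perturbation; corrections u^{-Δε'},
δ^{3-Δε}T-terms must be subleading locally uniformly; A could vanish.) [BilloEtAl2013,
GaiottoMazacPaulos2014, BilloEtAl2016, KadanoffCeva1971, KosPolandSimmonsDuffinVichi2016]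
#3 DisorderCircleInversion (crux) — [card N2, inversion clause for (n,k) = (2,1)] For the unit
disorder circle (flat disc D_{1/δ} of flipped vertical bonds, boundary = lattice circle of radius
1/δ in the plane x₃ = 0) the weight-free order–disorder ratio g_δ(x,y) := ⟨σ_{[x/δ]}σ_{[y/δ]}
μ⟩⁺⟨1⟩/(⟨σ_{[x/δ]}σ_{[y/δ]}⟩⁺⟨μ⟩⁺) at β_c(3) converges as δ → 0⁺, locally uniformly on pairs x ≠ y
both off the closed spanning disc {x₃ = 0, |x| ≤ 1} (across the open disc g jumps by the monodromy
sign −1; the disc itself is a gauge choice), to a limit g, and |g| is invariant under every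
inversion in a sphere containing the circle: |g(ι_h x, ι_h y)| = |g(x,y)| for ι_h the inversion of
centre (0,0,h) and radius (1+h²)^{1/2}, all h ∈ ℝ (h = 0 is the unit inversion, which fixes the
circle pointwise). These inversions and the rotations about the axis generate the 4-dimensional
conformal stabiliser SL(2,ℝ)×SO(2) of the circle, so g is a function of the two conformal invariants
of (x, y, C); by (L1)+switching g² is the conditional characteristic function of the linking parity
of the sourceless critical double current with C given x ↔ y. [deps: CardyDisorderCircle]
[difficulty: open-problem] (why it might fail: It is inversion covariance of an Ising scaling limit
— open on ℤ³ in every sector (DuminilCopinICM2022 §8.4); existence of the limit is itself open; the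
conformal-defect hypothesis of r2 enters; no discrete mechanism for ι_h on ℤ³ is known.)
[BilloEtAl2013, GaiottoMazacPaulos2014, DuminilCopinICM2022 §8.1 p.25 and §8.4 p.29,
AizenmanEtAl2019 §6, Literature.Barriers.CriticalPhenomena.ScaleCovarianceNotMoebius]
#4 SpinRatioMoebius (crux) — [the k = 0 corner, card assembly; shared in spirit with card
current-connection-invariance] There is a family q : CorrFamily 3, Möbius covariant with weight 0
(i.e. INVARIANT under translations, O(3), dilations and the unit inversion: IsMoebiusCovariant 0 q),
such that for every m the spin ratio ⟨σ_{[x₀/δ]}⋯σ_{[x_{2m−1}/δ]}⟩⁺_{β_c} / ∏_{j<m}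
⟨σ_{[x_j/δ]}σ_{[x_{j+m}/δ]}⟩⁺_{β_c} (no renormalisation ρ: it cancels) converges as δ → 0⁺ to
q_{2m}, locally uniformly on non-coincident configurations. By the switching lemma the lattice ratio
is ≥ 1 and is the reciprocal of a pairing probability of sourced double currents; q₂ ≡ 1.
Equivalent, given the two-point law, to existence + Möbius covariance of all spin n-point limits
(the conjunct minus (iii)), stated in the bounded-ratio currency of this line. [deps:
DisorderCircleInversion] [difficulty: open-problem] (why it might fail: Carries the whole open
content of clause (ii) for n ≥ 4 (existence of the limit, O(3) and inversion invariance on ℤ³: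
DuminilCopinICM2022 §8.4 p.29); pairing probabilities of 3D double currents have no known scaling
limit, let alone a Möbius-invariant one.) [DuminilCopinICM2022 §8.1 p.25 and §8.4 p.29,
Aizenman1982, DuminilCopin2016 Lemma 2.2, DuminilcopinLisQian2025 (2D only), PolandRychkovVichi2019
§II eq. (2)]
#5 IsingEuclidUpgradeR2RotInvPowerLaw (crux) — [shared item stmt-CriticalPhenomena-0634, verbatim]
the critical two-point function of the n.n. Ising model on ℤ³ is asymptotically an isotropic pure
power law: ⟨σ₀σ_x⟩⁺_{β_c(3)}·|x|₂^{2Δ} → c > 0 cofinitely. Supplies ρ(δ) = δ^{−Δ}, Δ ∈ [1/2,1]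
(criticalTwoPoint_bounds_holds) and the Möbius-covariant two-point factors of the Assembly.
[difficulty: open-problem] (why it might fail: η need not exist (log⟨σσ⟩/log|x| may oscillate inside
Δ ∈ [1/2,1]), log corrections or cubic anisotropy in the amplitude could survive; only
lace-expansion (d ≫ 4) and planar proofs of such asymptotics exist.) [DuminilCopinICM2022 §8.1 p.25,
DuminilCopinPanis2025LowerBounds Thm 1.5,
Literature.Probability.LatticeModels.criticalTwoPoint_bounds]
#6 IsingEuclidUpgradeR4NonGaussian (crux) — [shared item stmt-CriticalPhenomena-0636, verbatim]
every non-degenerate pointwise scaling limit of the renormalised critical Ising correlators on ℤ³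
has U₄ ≢ 0 on non-coincident configurations (imported: this line does not attack (iii); in its
currency U₄ = −2⟨σσ⟩⟨σσ⟩·P[double-current clusters meet]). [difficulty: open-problem] (why it might
fail: No proof that U₄ ≢ 0 in d = 3: the double-current intersection probability must stay positive
at macroscopic separation; RP long-range models on ℤ³ with α < 3/2 are Gaussian (Panis 2023).)
[AizenmanDuminilCopinAnnals2021 §3,
Literature.Barriers.CriticalPhenomena.IsingTrivialityFromDimensionFour,
Literature.Barriers.CriticalPhenomena.LongRangeTrivialityOnZ3]
#9 OddSpinCorrelationsVanish (support) — all odd critical plus-state correlators on ℤ³ vanish: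
⟨σ_{x₀}⋯σ_{x_{2m}}⟩⁺_{β_c(3)} = 0. From m*(β_c) = 0 for d ≥ 3
(spontaneousMagnetization_criticalBeta_eq_zero_holds, ADS 2015) and uniqueness of the critical Gibbs
state (hasUniqueGibbsMeasure_criticalBeta_of_ads / LebowitzMartinlof1972) plus spin-flip symmetry
(isingCorr_fixed_flip_holds): ⟨σ_A⟩⁺ = ⟨σ_A⟩⁻ = (−1)^{|A|}⟨σ_A⟩⁺. Needed by the Assembly for the
odd-n clauses of HasPointwiseScalingLimit. [difficulty: provable-now]
[AizenmanDuminilCopinSidoraviciusCMP2015 Thm 1.2, LebowitzMartinlof1972, Raoufi2020,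
Literature.Probability.LatticeModels.spontaneousMagnetization_criticalBeta_eq_zero_holds]
#9 LinkingParityRepresentation (support) — [card (L1), finite graph, provable now] For a finite
graph G, β ∈ ℝ, a set S of edges and A ⊆ V: ⟨σ_A · ∏_{e∈S} e^{−2βσ_e}⟩^{free}_{G;β,0} · Σ_{∂n=∅}
w_β(n) = Σ_{∂n=A} w_β(n)·(−1)^{Σ_{e∈S} n_e} — the random-current expansion with the couplings on S
flipped (expand e^{±βσ_e}; w_{±β}(n) = w_β(n)(−1)^{n(S)}), i.e. ⟨σ_Aμ_S⟩/⟨σ_A⟩ and ⟨μ_S⟩ are the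
characteristic functions of the mod-2 flux of the sourced / sourceless current through S. With
currentSum_switching_holds it gives G_C(x,y)² = E^{∅,∅}[(−1)^{(n₁+n₂)(S)} | x ↔
y]/E^{∅,∅}[(−1)^{(n₁+n₂)(S)}]. Proof = the proof of isingPartitionFunction_free_eq_holds /
isingCorr_free_eq_currentSum_div_holds with signed couplings (WeightedCurrents.wweight).
[difficulty: provable-now] [AizenmanEtAl2019 §6 p.30, KadanoffCeva1971, GriffithsHurstSherman1970,
DuminilCopin2016 §2.1 eq. (2.2),
Literature.Probability.LatticeModels.isingCorr_free_eq_currentSum_div_holds]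

TWO-LAYER PLAN. Foreseen glued splits (none filed now). CardyDisorderCircle ⇐ CircleProfileExists (a
subsequential/actual limit profile F(x) of the rescaled energy density exists and is continuous off
C) → ProfileRigidity (any limit profile that is invariant under the similarities fixing C and under
ONE sphere inversion through C is A·u_R^{−Δ}) → CardyDisorderCircle; ProfileRigidity is pure Möbius
geometry (provable now). DisorderCircleInversion ⇐ RatioLimitExists → LinkingLawInversion (inversion
invariance of the conditional linking-parity law of the sourceless double current, via
LinkingParityRepresentation + switching) → DisorderCircleInversion. SpinRatioMoebius ⇐ (m = 2 first:
the four-point pairing probability) → (induction on m by switching) → SpinRatioMoebius, or attach to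
the route of card current-connection-invariance if it opens.

KILL CRITERIA. (a) CardyDisorderCircle refuted — numerically (the one-amplitude shape test of §
Cheapest falsifier failing at the 5% level at R = 16–24, or A incompatible with BilloEtAl2013's line
amplitude a_ε) or in Lean (a limit profile exists and is not of the form A·u_R^{−Δ}) — closes the
route `refuted:CardyDisorderCircle`: the rigid (point, circle) sector was the whole bet; the k = 0
items (SpinRatioMoebius, 0634, 0636) survive in the other covariance routes / card
current-connection-invariance. (b) DisorderCircleInversion refuted with r2 standing (limit exists,
|g| not ι_h-invariant for some h) ⇒ the lattice twist loop is conformal only under similarities —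
close as refuted, file the witness as a barrier note ("linking statistics: scale without
inversion"). (c) SpinRatioMoebius, 0634 or 0636 refuted ⇒ the conjunct itself (clause
(ii)/(i)/(iii)) fails as typed — every covariance route breaks; not specific to this line. (d) If a
route for card current-connection-invariance opens with the same k = 0 assembly and a refuter grades
r2/r3 decorative, supersede this route into it keeping r2/r3 as wanted statements there.

NOT DECOMPOSED YET. The general (n,k) family (k ≥ 2 circles, tilted circles: needs a plaquette
discretisation of arbitrary round discs — definition request), the R → 0 fusion corner (card N4:
R^{−Δ_ε}(g(x/R,y/R) − 1) → B(|x−y|/(|x||y|))^{Δ_ε}, the Cassini law of card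
cassini-law-sigma-sigma-epsilon as a corollary), gauge invariance / surface independence of ⟨F μ_S⟩
(finite symmetric difference = coboundary ⇒ spin-flip change of variables; provers attach it with
--supports), the plus-state (ghost-vertex) version of LinkingParityRepresentation, a-priori Hölder
regularity/tightness of the ratios (AizenmanDuminilCopinAnnals2021 §5–6 style), and every constant.
No Target item: X is the conjunction named in § Thesis; the Assembly uses its k = 0 part only, by
design.

CHEAPEST FALSIFIER. Worm (or Swendsen–Wang with coupling signs) Monte Carlo of the n.n. Ising model
at β = 0.221654626 on a periodic 128³ box with the couplings of the vertical bonds {(p,0),(p,1)},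
|p| < R, flipped, R = 16 and 24: measure ⟨J_bσ_b⟩_C − ⟨σ_b⟩ (i) along the axis x = (0,0,z), where
u_R = (z²+R²)/(2R), and (ii) in the plane, x = (ρ,0,0), ρ > R, where u_R = (ρ²−R²)/(2R); with Δ_ε =
1.41263 FIXED, fit ONE amplitude on ray (i) and predict ray (ii) with zero parameters (and A itself
from BilloEtAl2013's straight-line a_ε on the same lattice with the same probe). A shape mismatch
beyond 5% at distances 4 ≤ u_R ≤ R/2 (after the leading correction u^{−Δ_ε'}≈u^{−3.83} is allowed
for) retires r2 and closes the route. Cost: CPU-hours. Not run by the planner (compute-free hub; no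
kit job filed in plancard mode) — refuters first.

NUMBERS. Δ_ε = 1.412625(10), Δ_σ = 0.5181489(10) (KosPolandSimmonsDuffinVichi2016 §1); BilloEtAl2013
§2 p.6 uses Δ_ε = 1.4130(5), Δ_σ = 0.5182(2) and measures the line amplitude ratio C^ε_1 = a_ε/√c_εε
(§4 p.10, Table "universal ratios") and the lowest defect primary Δ_{ψ_{1/2}} ≈ 0.9187 (used as
input d = 0.9187 in GaiottoMazacPaulos2014 §4 p.12); GaiottoMazacPaulos2014 §3.3 p.7: C^ε_1 at one
loop in 4−ε. Rigorous window for the spin dimension: Δ ∈ [1/2, 1] (criticalTwoPoint_bounds_holds;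
DuminilCopinPanis2025LowerBounds: η ≤ 1/2 if it exists). Conformal stabiliser of a circle in Möb(3)
≅ SO(4,1): dimension 4; (point, circle) configurations: 3 + 6 = 9 < 10 ⇒ open orbit, no invariant;
(2 points, circle): 12 − 10 = 2 invariants. Items at open: 8 (5 cruxes, 2 support, 1 assembly; no
target item).

DEFINITION REQUESTS. (1) `twistedPlusExpect` / disorder insertion
(Literature/Probability/LatticeModels): for a finite set S of bonds of ℤ^d, ⟨f⟩_S := plusExpect d β
0 (f·exp(−2β Σ_{b∈S} σ_b)) / plusExpect d β 0 (exp(−2β Σ_{b∈S} σ_b)), with the gauge lemma (S Δ S' =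
coboundary of a finite B ⇒ ⟨f⟩_S = ⟨f ∘ flip_B⟩_{S'}) — would shorten r2/r3 from ~2 kchar to one
line each and type the general (n,k) family. (2) `latticeDisc` : plaquette discretisation of a round
disc (centre c, radius R, unit normal ν) = the bonds of ℤ³ whose open segment meets the disc —
needed for tilted circles / full Möb(3) statements. (3) mod-2 flux of a Current through a bond set
(= Σ_{e∈S} n e mod 2; inlined today). Filed after open with `ledger workitem add --kind definition`.

Novelty: Searches (2026-08-15, this planner; the card was audited new-combination by
refuter-novelty-audit-…-5-0 who READ AizenmanEtAl2019 §6 p.30 and BilloEtAl2013 §3 p.5): `lit search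
--hybrid "disorder operator twist defect Ising three dimensions"` (8 book hits: Fradkin 2013 ch. on
ℤ₂ gauge duality, Di Francesco 1997 — background only); crossref "twist line defect
three-dimensional Ising Monte Carlo" (10, none relevant), "bootstrapping 3d Ising twist defect" (→
doi:10.1007/jhep03(2014)100, read §3.3 p.7), "line defects 3d Ising model Billo Caselle" (→
doi:10.1007/jhep07(2013)055, read §3 p.5, §4 p.10), "Kadanoff Ceva operator algebra disorder
variable" (→ doi:10.1103/physrevb.3.3918), "emergent planarity finite-range" (→
doi:10.1007/s00222-018-00851-4), "higher-form symmetry breaking Ising transitions" (→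
doi:10.1103/physrevresearch.3.033024, read p.12: ⟨X_M⟩ perimeter law + corner logs in the 2+1-d
quantum model; "a line defect is nothing but the boundary of a disorder operator"), "monodromy
defects hyperbolic space" (doi:10.1007/jhep02(2022)041), "conformal invariance double random
currents" (doi:10.1112/plms.70022, 2D); s2 "scaling disorder operator Ising quantum criticality" (8:
arXiv:2106.01380, arXiv:2101.10358 — ⟨μ⟩ scaling at (2+1)d criticalities); `lit frontier
CriticalPhenomena --since 2021` (30 rows; arXiv:2604.05772 geometric clusters in 3D Ising, read p.1
— unrelated), `lit bridges CriticalPhenomena --cross any` (30 rows, nothing on defects); `lit galaxy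
search "twist  [refs: 10.1007/jhep03(2014, 10.1007/jhep07(2013, 10.1103/physrevb.3.3918, 10.1007/s00222-018-00851-4, 10.1103/physrevresearch.3.033024, 10.1007/jhep02(2022, 10.1112/plms.70022, 2106.01380, 2101.10358, 2604.05772, doi:10.1007/jhep03, doi:10.1007/jhep07, doi:10.1103/physrevb.3.3918, doi:10.1007/s00222-018-00851-4, doi:10.1103/physrevresearch.3.033024, doi:10.1007/jhep02, doi:10.1112/plms.70022, AizenmanEtA]

Barriers (technique_class: disorder-loop, linking-parity, defect-cardy-formula): - technique_class: disorder-loop, linking-parity, defect-cardy-formula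
- Literature.Barriers.CriticalPhenomena.LiouvilleRigidity: evaded by design — no Riemann map,
Loewner chain or SLE step; only the 10-parameter Möbius group is used, and where it is strongest
(open orbit on point–circle pairs; sphere inversions fixing a circle), which is meaningful in d = 3
(LiouvilleRigidityNarrow: Möbius covariance is all clause (ii) asks).
- Literature.Barriers.CriticalPhenomena.ScaleCovarianceNotMoebius: no abstract upgrade
Euclidean+scale ⇒ inversion is claimed; inversion invariance is a separate, Ising-specific crux (r3)
about linking statistics of currents, and r2 packages inversion covariance into a falsifiable closed
shape; the barrier's witness family (bare kernels ‖a−b‖⁻², no current/defect structure) says nothing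
about these statements — conceded: nothing here yet PROVES inversion invariance either; the bet is
that a bounded topological statistic with a rigid target is the tractable place to find the discrete
mechanism.
- Literature.Barriers.CriticalPhenomena.BootstrapLatticeBlindness: respected — bootstrap/MC data
(Δ_ε, a_ε, defect spectrum) enter only as predicted VALUES in r2 and as numerical cross-checks;
every item quantifies over the lattice family criticalCorr 3 / plusExpect with explicit disorder
insertions, so no conclusion is lattice-blind and no step infers convergence from CFT consistency.
- Literature.Barriers.CriticalPhenomena.IsingTrivialityFromDimensionFour: U₄ ≢

Novelty grade: new-combination — ROUTE REVIEW gen-2 addendum (refuter …-32c464e2-g2-0, 2026-08-15 14:32Z; texts REVIEW_R2.md [gen-0] + REVIEW_G2.md [g2] on stmt-4533). Grade unchanged: new-combination (card audit + gen-0; lit services unavailable this session). Re-verified: 8/8 decls elaborate (W2.lean rc0). 4532 LinkingParityRepre (refuter refuter-rreview-route-CriticalPhenomena--32c464e2-g2-0, 2026-08-15T14:31:42Z; prior: BilloEtAl2013 doi:10.1007/jhep07(2013)055, GaiottoMazacPaulos2014 doi:10.1007/jhep03(2014)100, BilloEtAl2016 (defect CFT kinematics), AizenmanEtAl2019 §6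 (order–disorder via random currents), KadanoffCeva1971 doi:10.1103/physrevb.3.3918, Wegner1971, route CurrentConnectionInvariance (stmt-4840/4841/4842, open))

History (route lifecycle, newest last):
- 2026-08-24T20:57:20Z · DORMANT — reconciler: no traction for 7.1 d (last activity item-evidence-added at 2026-08-17T18:45:47Z); parked, not closed — `ledger route dormant route-CriticalPhenomen (operator:999:2518914)
- 2026-08-27T15:17:42Z · REACTIVATED — reconciler: reactivated — activity statement-checked at 2026-08-27T13:50:46Z after parking at 2026-08-24T20:57:20Z (operator:999:373706)
- 2026-08-29T19:34:58Z · DORMANT — census g0: costume|duplicate of —; reader census-reader-38-g0 (operator:999:1331931)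

sub-problem: Ising3DConformalLimit · status: dormant · opened planner-plancard-CriticalPhenomena-Ising3DCon-9d2a627d-0 2026-08-15T11:34:28Z · rev 4 · ledger route-CriticalPhenomena-LinkingParityCircles
GENERATED by the gate from the ledger (D-0016/17). Provers cite these decls: `theorem foo : Summit.CriticalPhenomena.Ising3DConformalLimit.Theses.LinkingParityCircles.<Decl> := …` in Summits/CriticalPhenomena/Ising3DConformalLimit/Theorems/<Name>.lean.
-/

namespace Summit.CriticalPhenomena.Ising3DConformalLimit.Theses.LinkingParityCircles

open scoped BigOperators Topology Manifold Classical MeasureTheory ProbabilityTheory Matrix InnerProductSpace ComplexConjugate ContinuousMap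
open Filter Set Function TopologicalSpace MeasureTheory

attribute [summit_statement] _root_.Ising3DConformalLimit

/-- item stmt-CriticalPhenomena-4528 · crux · rank 2 · open · by planner
why it might fail: Premise unproved: the lattice twist loop flowing to a CONFORMAL line defect has MC/bootstrap support only (BilloEtAl2013 §4, GMP2014); rigorous order–disorder limits exist only in 2D (CHI2021 Thm 1.2); existence of the δ→0 profile on ℤ³ is itself open; A≠0 and uniform subleading corrections unproved
sources: BilloEtAl2013 §3 p.5, §4 p.10 (arXiv:1304.4110), GaiottoMazacPaulos2014 §3.3, BilloEtAl2016 §2.3 p.8 (one-point functions at a spherical defect), KadanoffCeva1971, ChelkakHonglerIzyurov2021 Thm 1.2 p.6 (2D only), DuminilCopinICM2022 §8.4 p.29 (arXiv:2208.00864)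
[crux] [card N3, the entry theorem] There are Δ_ε > 0 and A ≠ 0 such that for every radius R > 0 and
every bond direction i ∈ {0,1,2}: with D_{R/δ} the set of vertical bonds {(p,0),(p,1)}, p ∈ ℤ²,
p₁²+p₂² < (R/δ)² (a flat disc of flipped couplings whose boundary is the lattice circle of radius
R/δ), μ := exp(−2β_c Σ_{b∈D} σ_b), ε_b(x) := J_b σ_{[x/δ]}σ_{[x/δ]+e_i} the energy density of the
TWISTED Hamiltonian (J_b = −1 on the flipped bonds, else +1: gauge-covariant, no artefact on the
disc), the rescaled profile δ^{−Δ_ε}·(⟨ε_b(x) μ⟩⁺_{β_c}/⟨μ⟩⁺_{β_c} − ⟨σ_0σ_{e_i}⟩⁺_{β_c}) converges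
as δ → 0⁺, locally uniformly on ℝ³ minus the circle {x₃ = 0, |x| = R}, to A·u_R(x)^{−Δ_ε} with
u_R(x) = ((|x|²−R²)² + 4R²x₃²)^{1/2}/(2R). One exponent, one amplitude, no free function: scale
covariance (A independent of R), isotropy (A independent of i) and inversion covariance (the shape
u_R, Möbius image of the straight-line law a_ε|x_⊥|^{−Δ_ε}) in a single formula; A/a_ε = 1 is
predicted by BilloEtAl2013's measured line amplitude on the same lattice with the same probe.
[difficulty: open-problem] -/
@[route_item "route-CriticalPhenomena-LinkingParityCircles", crux]
def CardyDisorderCircle : Prop :=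
  ∃ Δε A : ℝ, 0 < Δε ∧ A ≠ 0 ∧ ∀ R : ℝ, 0 < R → ∀ i : Fin 3, TendstoLocallyUniformlyOn (fun (δ : ℝ) (x : EuclideanSpace ℝ (Fin 3)) => δ ^ (-Δε) * ((if i = 2 ∧ (Literature.Probability.LatticeModels.latticeApprox δ x) 2 = 0 ∧ (((Literature.Probability.LatticeModels.latticeApprox δ x) 0 : ℝ)) ^ 2 + (((Literature.Probability.LatticeModels.latticeApprox δ x) 1 : ℝ)) ^ 2 < (R / δ) ^ 2 then (-1 : ℝ) else 1) * Literature.Probability.LatticeModels.plusExpect 3 (Literature.Probability.LatticeModels.criticalBeta 3) 0 (fun σ => Literature.Probability.LatticeModels.spinAt (Literature.Probability.LatticeModels.latticeApprox δ x) σ * Literature.Probability.LatticeModels.spinAt (Literature.Probability.LatticeModels.latticeApprox δ x + Pi.single i 1) σ * Real.exp (-2 * Literature.Probability.LatticeModels.criticalBeta 3 * ∑ p ∈ ((Finset.Icc (-⌈R / δ⌉) ⌈R / δ⌉) ×ˢ (Finset.Icc (-⌈R / δ⌉) ⌈R / δ⌉)).filter (fun p : ℤ × ℤ => ((p.1 :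 ℝ)) ^ 2 + ((p.2 : ℝ)) ^ 2 < (R / δ) ^ 2), Literature.Probability.LatticeModels.spinAt (![p.1, p.2, 0] : Literature.Probability.LatticeModels.Site 3) σ * Literature.Probability.LatticeModels.spinAt (![p.1, p.2, 1] : Literature.Probability.LatticeModels.Site 3) σ)) / Literature.Probability.LatticeModels.plusExpect 3 (Literature.Probability.LatticeModels.criticalBeta 3) 0 (fun σ => Real.exp (-2 * Literature.Probability.LatticeModels.criticalBeta 3 * ∑ p ∈ ((Finset.Icc (-⌈R / δ⌉) ⌈R / δ⌉) ×ˢ (Finset.Icc (-⌈R / δ⌉) ⌈R / δ⌉)).filter (fun p : ℤ × ℤ => ((p.1 : ℝ)) ^ 2 + ((p.2 : ℝ)) ^ 2 < (R / δ) ^ 2), Literature.Probability.LatticeModels.spinAt (![p.1, p.2, 0] : Literature.Probability.LatticeModels.Site 3) σ * Literature.Probability.LatticeModels.spinAt (![p.1, p.2, 1] : Literature.Probability.LatticeModels.Site 3) σ)) - Literature.Probability.LatticeModels.criticalTwoPoint 3 (Pi.single i 1))) (fun x => A * (Real.sqrt ((‖x‖ ^ 2 - R ^ 2) ^ 2 +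 4 * R ^ 2 * (x 2) ^ 2) / (2 * R)) ^ (-Δε)) (nhdsWithin 0 (Set.Ioi 0)) {x | Real.sqrt ((‖x‖ ^ 2 - R ^ 2) ^ 2 + 4 * R ^ 2 * (x 2) ^ 2) ≠ 0}

/-- item stmt-CriticalPhenomena-4529 · crux · rank 3 · open · by planner
why it might fail: Asserts existence AND sphere-inversion invariance of a critical 3D Ising limit: conformal (even rotational) invariance on ℤ³ is open in every sector (DuminilCopinICM2022 §8.4 p.29); scale+Euclidean covariance does not force inversion (ScaleCovarianceNotMoebius); no discrete ι_h known; 2D only.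
sources: DuminilCopinICM2022 §8.1 p.25 and §8.4 p.29 (arXiv:2208.00864), Literature.Barriers.CriticalPhenomena.ScaleCovarianceNotMoebius, BilloEtAl2016 §2.1 p.6 (defect stabiliser so(p+1,1)×so(q)) and §2.3 p.8, BilloEtAl2013 §3 p.5, AizenmanEtAl2019 §6 pp.29–30 (order–disorder correlators as signed current sums), ChelkakHonglerIzyurov2021 Thm 1.2 (2D analogue)
[crux] [card N2, inversion clause for (n,k) = (2,1)] For the unit disorder circle (flat disc D_{1/δ}
of flipped vertical bonds, boundary = lattice circle of radius 1/δ in the plane x₃ = 0) the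
weight-free order–disorder ratio g_δ(x,y) := ⟨σ_{[x/δ]}σ_{[y/δ]} μ⟩⁺⟨1⟩/(⟨σ_{[x/δ]}σ_{[y/δ]}⟩⁺⟨μ⟩⁺)
at β_c(3) converges as δ → 0⁺, locally uniformly on pairs x ≠ y both off the closed spanning disc
{x₃ = 0, |x| ≤ 1} (across the open disc g jumps by the monodromy sign −1; the disc itself is a gauge
choice), to a limit g, and |g| is invariant under every inversion in a sphere containing the circle:
|g(ι_h x, ι_h y)| = |g(x,y)| for ι_h the inversion of centre (0,0,h) and radius (1+h²)^{1/2}, all h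
∈ ℝ (h = 0 is the unit inversion, which fixes the circle pointwise). These inversions and the
rotations about the axis generate the 4-dimensional conformal stabiliser SL(2,ℝ)×SO(2) of the
circle, so g is a function of the two conformal invariants of (x, y, C); by (L1)+switching g² is the
conditional characteristic function of the linking parity of the sourceless critical double current
with C given x ↔ y. [deps: CardyDisorderCircle] [difficulty: open-problem] -/
@[route_item "route-CriticalPhenomena-LinkingParityCircles", crux]
def DisorderCircleInversion : Prop :=
  ∃ g : EuclideanSpace ℝ (Fin 3) → EuclideanSpace ℝ (Fin 3) → ℝ, TendstoLocallyUniformlyOn (fun (δ : ℝ) (p : EuclideanSpace ℝ (Fin 3) × EuclideanSpace ℝ (Fin 3)) => Literature.Probability.LatticeModels.plusExpect 3 (Literature.Probability.LatticeModels.criticalBeta 3) 0 (fun σ => Literature.Probability.LatticeModels.spinAt (Literature.Probability.LatticeModels.latticeApprox δ p.1) σ * Literature.Probability.LatticeModels.spinAt (Literature.Probability.LatticeModels.latticeApprox δ p.2) σ * Real.exp (-2 * Literature.Probability.LatticeModels.criticalBeta 3 * ∑ c ∈ ((Finset.Icc (-⌈1 / δ⌉) ⌈1 / δ⌉) ×ˢ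 (Finset.Icc (-⌈1 / δ⌉) ⌈1 / δ⌉)).filter (fun c : ℤ × ℤ => ((c.1 : ℝ)) ^ 2 + ((c.2 : ℝ)) ^ 2 < (1 / δ) ^ 2), Literature.Probability.LatticeModels.spinAt (![c.1, c.2, 0] : Literature.Probability.LatticeModels.Site 3) σ * Literature.Probability.LatticeModels.spinAt (![c.1, c.2, 1] : Literature.Probability.LatticeModels.Site 3) σ)) / (Literature.Probability.LatticeModels.plusExpect 3 (Literature.Probability.LatticeModels.criticalBeta 3) 0 (fun σ => Literature.Probability.LatticeModels.spinAt (Literature.Probability.LatticeModels.latticeApprox δ p.1) σ * Literature.Probability.LatticeModels.spinAt (Literature.Probability.LatticeModels.latticeApprox δ p.2) σ) * Literature.Probability.LatticeModels.plusExpect 3 (Literature.Probability.LatticeModels.criticalBeta 3) 0 (fun σ => Real.exp (-2 * Literature.Probability.LatticeModels.criticalBeta 3 * ∑ c ∈ ((Finset.Icc (-⌈1 / δ⌉) ⌈1 / δ⌉) ×ˢ (Finset.Icc (-⌈1 / δ⌉) ⌈1 / δ⌉)).filter (fun c : ℤ × ℤ => ((c.1 : ℝ)) ^ 2 + ((c.2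 : ℝ)) ^ 2 < (1 / δ) ^ 2), Literature.Probability.LatticeModels.spinAt (![c.1, c.2, 0] : Literature.Probability.LatticeModels.Site 3) σ * Literature.Probability.LatticeModels.spinAt (![c.1, c.2, 1] : Literature.Probability.LatticeModels.Site 3) σ)))) (fun p => g p.1 p.2) (nhdsWithin 0 (Set.Ioi 0)) {p | p.1 ≠ p.2 ∧ (p.1 2 ≠ 0 ∨ 1 < ‖p.1‖) ∧ (p.2 2 ≠ 0 ∨ 1 < ‖p.2‖)} ∧ ∀ (h : ℝ) (x y : EuclideanSpace ℝ (Fin 3)), x ≠ y → (x 2 ≠ 0 ∨ 1 < ‖x‖) → (y 2 ≠ 0 ∨ 1 < ‖y‖) → x ≠ EuclideanSpace.single 2 h → y ≠ EuclideanSpace.single 2 h → |g (EuclideanGeometry.inversion (EuclideanSpace.single 2 h) (Real.sqrt (1 + h ^ 2)) x) (EuclideanGeometry.inversion (EuclideanSpace.single 2 h) (Real.sqrt (1 + h ^ 2)) y)| = |g x y|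

/-- item stmt-CriticalPhenomena-4530 · crux · rank 4 · open · by planner
why it might fail: The open core of clause (ii): existence plus full Möbius (O(3) and inversion) invariance of every 2m-point spin-ratio limit on ℤ³ — 3D Ising → CFT convergence is 'widely open' (DuminilCopinICM2022 §8.4 p.29); double-current pairing probabilities have an identified conformal limit only in 2D (DLQ25)
sources: DuminilCopinICM2022 §8.1 p.25 and §8.4 p.29 (arXiv:2208.00864), Aizenman1982 §3, Literature.Probability.LatticeModels.currentSum_switching_holds (switching lemma; DuminilCopin2016 = arXiv:1607.06933, Lemma 3.1 p.8 in the held text), DuminilcopinLisQian2025 (doi:10.1112/plms.70022; 2D only), PolandRychkovVichi2019 §II eq. (2)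
[crux] [the k = 0 corner, card assembly; shared in spirit with card current-connection-invariance]
There is a family q : CorrFamily 3, Möbius covariant with weight 0 (i.e. INVARIANT under
translations, O(3), dilations and the unit inversion: IsMoebiusCovariant 0 q), such that for every m
the spin ratio ⟨σ_{[x₀/δ]}⋯σ_{[x_{2m−1}/δ]}⟩⁺_{β_c} / ∏_{j<m} ⟨σ_{[x_j/δ]}σ_{[x_{j+m}/δ]}⟩⁺_{β_c}
(no renormalisation ρ: it cancels) converges as δ → 0⁺ to q_{2m}, locally uniformly on
non-coincident configurations. By the switching lemma the lattice ratio is ≥ 1 and is the reciprocal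
of a pairing probability of sourced double currents; q₂ ≡ 1. Equivalent, given the two-point law, to
existence + Möbius covariance of all spin n-point limits (the conjunct minus (iii)), stated in the
bounded-ratio currency of this line. [deps: DisorderCircleInversion] [difficulty: open-problem] -/
@[route_item "route-CriticalPhenomena-LinkingParityCircles", crux]
def SpinRatioMoebius : Prop :=
  ∃ q : Literature.Probability.LatticeModels.CorrFamily 3, Literature.Probability.LatticeModels.IsMoebiusCovariant 0 q ∧ ∀ m : ℕ, TendstoLocallyUniformlyOn (fun (δ : ℝ) (x : Fin (m + m) → EuclideanSpace ℝ (Fin 3)) => Literature.Probability.LatticeModels.criticalCorr 3 (m + m) (fun i => Literature.Probability.LatticeModels.latticeApprox δ (x i)) / ∏ j : Fin m, Literature.Probability.LatticeModels.criticalCorr 3 2 ![Literature.Probability.LatticeModels.latticeApprox δ (x (Fin.castAdd m j)), Literature.Probability.LatticeModels.latticeApprox δ (x (Fin.natAdd m j))]) (q (m + m)) (nhdsWithin 0 (Set.Ioi 0)) (Literature.Probability.LatticeModels.NonCoincident 3 (m + m))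

/-- item stmt-CriticalPhenomena-0634 · crux · rank 5 · open · by planner
why it might fail: η need not exist: log⟨σ₀σ_x⟩/log|x| may oscillate inside the a-priori window Δ∈[1/2,1] (DCP2025 Thm 1.5 gives η≤1/2, i.e. Δ≤3/4, only IF η exists); a log correction or cubic-anisotropic amplitude c(x/|x|) falsifies the isotropic pure law; proved only by lace expansion (d>4, Sakai2007) and in 2D.
sources: DuminilCopinPanis2025LowerBounds Thm 1.5 p.6 (arXiv:2404.05700), Literature.Probability.LatticeModels.dcp_isingEta_le_half, Literature.Probability.LatticeModels.criticalTwoPoint_bounds, DuminilCopinICM2022 §8.1 p.25, Sakai2007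
Crux r2 (hardest, most informative): the critical two-point function of the n.n. Ising model on Z^3
is asymptotically a rotation-invariant pure power law: there are Δ and c>0 with ⟨σ_0 σ_x⟩_{β_c(3)} ·
|x|_2^{2Δ} → c as |x| → ∞ (Euclidean norm, cofinite filter on Z^3). Gives existence of η = 2Δ−1,
forces ρ(δ) ≍ δ^{-Δ}, and is rotation invariance at the two-point level (open on Z^3: Duminil-Copin
ICM2022 arXiv:2208.00864 §8; 2-D analogue for FK models: DKKMO arXiv:2012.11672). Known input:
c|x|^{-2} ≤ ⟨σ0σx⟩ ≤ C|x|^{-1} (Literature.Probability.LatticeModels.criticalTwoPoint_bounds), so Δ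
∈ [1/2,1] if it exists. -/
@[route_item "route-CriticalPhenomena-LinkingParityCircles", crux]
def IsingEuclidUpgradeR2RotInvPowerLaw : Prop :=
  ∃ Δ c : ℝ, 0 < c ∧ Filter.Tendsto (fun x : Literature.Probability.LatticeModels.Site 3 => Literature.Probability.LatticeModels.criticalTwoPoint 3 x * Real.sqrt (∑ i, ((x i : ℝ)) ^ 2) ^ (2 * Δ)) Filter.cofinite (nhds c)

/-- item stmt-CriticalPhenomena-0636 · crux · rank 6 · open · by planner
why it might fail: No proof that U₄≢0 in d=3: by U₄ = −2⟨σσ⟩⟨σσ⟩·P[double-current clusters meet] (ADC2021 §3.2 p.9) the intersection probability must stay positive at macroscopic separation; RP long-range Ising on ℤ³ with α<3/2 IS Gaussian (Panis2023 Thm 1.2: d−2(α∧2)>0): no interaction-uniform argument works.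
sources: AizenmanDuminilCopinAnnals2021 §3.2 p.9 (arXiv:1912.07973), Aizenman1982 §3, Panis2023Triviality Thm 1.2 p.6 (arXiv:2309.05797), Literature.Barriers.CriticalPhenomena.IsingTrivialityFromDimensionFour, Literature.Barriers.CriticalPhenomena.LongRangeTrivialityOnZ3
Crux r4 (non-triviality in d=3): every non-degenerate pointwise scaling limit S of the renormalised
critical Ising correlators on Z^3 has connected four-point function U4 ≢ 0 on non-coincident
configurations. Intended tool: the random-current identity U4(x,y,z,t) =
−2⟨σxσy⟩⟨σzσt⟩·P^{xy,zt}[C_{n1+n2}(x) ∩ C_{n1+n2}(z) ≠ ∅] (Aizenman 1982; ADC2021 arXiv:1912.07973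
eq. (3.11)): non-Gaussianity ⇔ the intersection probability of the two double-current clusters at
macroscopic separation does not vanish as δ → 0. Contrast: for d ≥ 4 every such limit IS Gaussian
(Literature.Probability.LatticeModels.highDim_triviality). Its negation refutes the conjunct
Ising3DConformalLimit itself. -/
@[route_item "route-CriticalPhenomena-LinkingParityCircles", crux]
def IsingEuclidUpgradeR4NonGaussian : Prop :=
  ∀ (ρ : ℝ → ℝ) (S : Literature.Probability.LatticeModels.CorrFamily 3), (∀ δ ∈ Set.Ioc (0:ℝ) 1, 0 < ρ δ) → Literature.Probability.LatticeModels.HasPointwiseScalingLimit (Literature.Probability.LatticeModels.criticalCorr 3) ρ S → Literature.Probability.LatticeModels.IsNondegenerateTwoPoint S → Literature.Probability.LatticeModels.HasNontrivialU4 S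

/-- item stmt-CriticalPhenomena-4531 · support · rank 9 · open · by planner
sources: AizenmanDuminilCopinSidoraviciusCMP2015 Thm 1.2, LebowitzMartinlof1972, Raoufi2020, Literature.Probability.LatticeModels.spontaneousMagnetization_criticalBeta_eq_zero_holds
[support] all odd critical plus-state correlators on ℤ³ vanish: ⟨σ_{x₀}⋯σ_{x_{2m}}⟩⁺_{β_c(3)} = 0.
From m*(β_c) = 0 for d ≥ 3 (spontaneousMagnetization_criticalBeta_eq_zero_holds, ADS 2015) and
uniqueness of the critical Gibbs state (hasUniqueGibbsMeasure_criticalBeta_of_ads /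
LebowitzMartinlof1972) plus spin-flip symmetry (isingCorr_fixed_flip_holds): ⟨σ_A⟩⁺ = ⟨σ_A⟩⁻ =
(−1)^{|A|}⟨σ_A⟩⁺. Needed by the Assembly for the odd-n clauses of HasPointwiseScalingLimit.
[difficulty: provable-now] -/
@[route_item "route-CriticalPhenomena-LinkingParityCircles", crux]
def OddSpinCorrelationsVanish : Prop :=
  ∀ (m : ℕ) (x : Fin (2 * m + 1) → Literature.Probability.LatticeModels.Site 3), Literature.Probability.LatticeModels.criticalCorr 3 (2 * m + 1) x = 0

/-- item stmt-CriticalPhenomena-4532 · support · rank 9 · open · by planner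
sources: AizenmanEtAl2019 §6 p.30, KadanoffCeva1971, GriffithsHurstSherman1970, DuminilCopin2016 §2.1 eq. (2.2), Literature.Probability.LatticeModels.isingCorr_free_eq_currentSum_div_holds
[support] [card (L1), finite graph, provable now] For a finite graph G, β ∈ ℝ, a set S of edges and
A ⊆ V: ⟨σ_A · ∏_{e∈S} e^{−2βσ_e}⟩^{free}_{G;β,0} · Σ_{∂n=∅} w_β(n) = Σ_{∂n=A} w_β(n)·(−1)^{Σ_{e∈S}
n_e} — the random-current expansion with the couplings on S flipped (expand e^{±βσ_e}; w_{±β}(n) =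
w_β(n)(−1)^{n(S)}), i.e. ⟨σ_Aμ_S⟩/⟨σ_A⟩ and ⟨μ_S⟩ are the characteristic functions of the mod-2 flux
of the sourced / sourceless current through S. With currentSum_switching_holds it gives G_C(x,y)² =
E^{∅,∅}[(−1)^{(n₁+n₂)(S)} | x ↔ y]/E^{∅,∅}[(−1)^{(n₁+n₂)(S)}]. Proof = the proof of
isingPartitionFunction_free_eq_holds / isingCorr_free_eq_currentSum_div_holds with signed couplings
(WeightedCurrents.wweight). [difficulty: provable-now] -/
@[route_item "route-CriticalPhenomena-LinkingParityCircles", crux]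
def LinkingParityRepresentation : Prop :=
  ∀ (V : Type) [Fintype V] [DecidableEq V] (G : SimpleGraph V) [DecidableRel G.Adj] (β : ℝ) (S : Finset G.edgeFinset) (A : Finset V), Literature.Probability.LatticeModels.isingExpect G Finset.univ β 0 Literature.Probability.LatticeModels.BoundaryCondition.free (fun σ => Literature.Probability.LatticeModels.spinProduct A σ * Real.exp (-2 * β * ∑ e ∈ S, Literature.Probability.LatticeModels.bondSpin σ (e : Sym2 V))) * Literature.Probability.LatticeModels.currentSum G β ∅ = ∑' n : Literature.Probability.LatticeModels.Current G, if n.sources = A then n.weight β * (-1) ^ (∑ e ∈ S, n e) else 0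

/-- item stmt-CriticalPhenomena-4533 · assembly · rank 1 · open · by planner
sources: ChelkakHonglerIzyurov2015 Thm 1.2 (shape), DuminilCopinICM2022 §8.1, idea card linking-parity-cardy-disorder-circles (Assembly sketch)
[assembly] SpinRatioMoebius → OddSpinCorrelationsVanish → IsingEuclidUpgradeR2RotInvPowerLaw →
IsingEuclidUpgradeR4NonGaussian → Ising3DConformalLimit. -/
@[route_item "route-CriticalPhenomena-LinkingParityCircles", crux]
def Assembly : Prop :=
  SpinRatioMoebius → OddSpinCorrelationsVanish → IsingEuclidUpgradeR2RotInvPowerLaw → IsingEuclidUpgradeR4NonGaussian → Ising3DConformalLimit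

/-! D-0027 §2.1 — DECIDING THEOREM (planner-authored via `route open/edit --closes-file`; by operator:999:2941348 2026-08-15T15:23:50Z):
its hypotheses are this route's items and its conclusion the sub-problem Statement (glue_lint), and it elaborates with this file. -/

@[closes "route-CriticalPhenomena-LinkingParityCircles"] theorem closes : CardyDisorderCircle → DisorderCircleInversion → SpinRatioMoebius → IsingEuclidUpgradeR2RotInvPowerLaw → IsingEuclidUpgradeR4NonGaussian → OddSpinCorrelationsVanish → LinkingParityRepresentation → Assembly → _root_.Ising3DConformalLimit := fun h_CardyDisorderCircle h_DisorderCircleInversion h_SpinRatioMoebius h_IsingEuclidUpgradeR2RotInvPowerLaw h_IsingEuclidUpgradeR4NonGaussian h_OddSpinCorrelationsVanish h_LinkingParityRepresentation h_Assembly => h_Assembly h_SpinRatioMoebius h_OddSpinCorrelationsVanish h_IsingEuclidUpgradeR2RotInvPowerLaw h_IsingEuclidUpgradeR4NonGaussian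

end Summit.CriticalPhenomena.Ising3DConformalLimit.Theses.LinkingParityCircles
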